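import Summits.ABC.IUTFork.Cor312LicenceBallPairsRealising
import Summits.ABC.IUTFork.Cor312LicenceTameExactGenuineK
import HarnessLib

/-!
# [IUTchIII] Cor. 3.12, branch C — at GENUINE `K`-level data whose bad fibres are TORSION-FREE SUB-WILD of ARBITRARY indices
# (`e(x|p) ≤ p − 1`, `ζ_p ∉ K_x`; strata U1 ∪ U1½ mixed) the per-datum hull licence (and the S_H antecedent) is ONE explicit integer
# predicate on PAIRS of bad places: `∀ bad w, y | p, ∀ j ≤ l⋆: e_y·(e_w·min(D_{j,w}, D_{j,y}) + 1) ≤ e_y·P_w + j·e_w·(e_y − 1)`,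
# `D_{j,x} = (j²·P_x − 1) div e(x|p)`, `2l·P_x = e(x|v)·ord_v(q_v)`

PROOF-ONLY record file (no `def`, no new `Prop`, no instance) of the abc-iut cell (prover seat abc-iut-w4-d006, gen 6; D-0079 R-W row
«W:T1½-PAIRS BALL-FIBRES lane=U», genuine-`K` reading). TAKES NO SIDE on [IUTchIII] Cor. 3.12 or on any author. It is gen 5's
`Cor312LicenceTamePairsGenuineK.lean` (p452876: arbitrary TAME bad fibres) with tameness RELAXED to «`e(x|p) ≤ p − 1` and no `ζ ≠ 1` with
`ζ^p = 1` in `K_x`»: reads `licence_settingPrVolSharp_iff_of_realises_boundary_pairs` (`Cor312LicenceBallPairsRealising`) at the GENUINE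
`K`-level Dupuy–Hilado datum `X := Cor312Prov.pilotDataOfK D K` of a collection of initial Θ-data `D` ([IUTchI] Def. 3.1), where the
q-degrees are integral for free (`P_q(w) = P_w ∈ ℕ`, `2l·P_w = e(w|v)·ord_v(q_v)`, [IUTchI] Ex. 3.2 (iv); abc-iut-w5-d009's
`exists_nat_qPilot_pilotDataOfK`). abc-iut-D1-prv's `licence_settingPrVolSharp_pilotDataOfK_iff_of_boundary` (p456609) is the sub-case of ONE
index per fibre; gen 5's p452876 the sub-case `e(x|p) ≤ p − 2`.

WHAT IS PROVED (namespace `Summit.ABC.IUTFork.Cor312Prov`; Θ- and q-ideles REALISING the pilot divisors of `X`; every place `x` of `K` over a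
prime `p` below a bad place with `p > 2`, `e(x|p) ≤ p − 1` and no non-trivial `p`-th root of unity in `K_x` — the indices free to DIFFER
inside the fibre, `K/ℚ` Galois NOT needed):
* **`licence_settingPrVolSharp_pilotDataOfK_iff_of_boundary_pairs`** — abc-iut-c312-1's `Thm311ToCor312.Licence` at abc-iut-c312-7's
  `settingPrVolSharp X …` holds IFF for every bad prime `p`, every label `j = i+1 ∈ 𝔽_l^⋇` and every PAIR of bad places `w, y | p`, for THE
  natural numbers `P_w = P_q(w)`, `P_y = P_q(y)`: `e_y·(e_w·min(D_{j,w}, D_{j,y}) + 1) ≤ e_y·P_w + j·e_w·(e_y − 1)`, `e_x = e(x|p)`;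
* **`exists_qPinned_and_hull_settingPrVolSharp_pilotDataOfK_iff_of_boundary_pairs`** — branch C's per-datum antecedent «∃ ρ qK, QPinned ∧
  PilotKummerCompatHull» (any columns) ⟺ the same predicate.
READING (numbers, not adjectives; nothing about print): in OUR sharp containers, with Dupuy–Hilado's typed (Ind1)/(Ind2) acting
independently on every (capsule slot, place), the per-datum S_H / (xi-f)-licence question at a genuine `K`-level datum all of whose bad
fibres lie in strata U1 ∪ U1½ is a DECIDABLE arithmetic predicate of `(e(x|p), e(x|v)·ord_v(q_v)/(2l), j)` over PAIRS of bad places above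
each bad prime — whatever the ramification pattern of `K` over that prime (e.g. a prime `p = 2l + 1` carrying bad places of index `2l` next
to bad places of smaller index). Existence of initial Θ-data meeting the hypothesis is NOT claimed here (bad primes `p ≤ e(w|p)`, and
`p = e(w|p) + 1` with `ζ_p ∈ K_w`, are WILD: R-W stratum U2). HONEST SCOPE: OUR containers; STRONGER-THAN-PRINT hull licence (referee lanes
A1/A2); nothing about the printed GLOBAL inequality or the NUMBER-level corollary; refuted-as-typed ≠ refuted-in-print; nothing asserts or
refutes [IUTchIII] Cor. 3.12; typed ≠ proved; instantiated ≠ endorsed.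
[cite: Mochizuki2012, IUTchI Def. 3.1 (b),(c) pp. 61–62; Ex. 3.2 (iv) p. 71; IUTchIII Cor. 3.12 p. 173–175, Step (xi) (xi-f) p. 184, Thm. 3.11 (i) p. 154]
[cite: DupuyHilado2025, §3.3, §3.4, §3.9, §4.7, §4.9] [cite: NeukirchANT1999, Ch. II Prop. (5.5)–(5.7), (6.8)] [claim: Mochizuki2012, status: disputed]
for every IUT sentence quoted.
-/

noncomputable section

open Set Function NumberField IsDedekindDomain
open scoped Pointwise

namespace Summit.ABC.IUTFork.Cor312Prov

open Thm311 Thm311.Real Cor312 Cor312.Setting Cor312Vol Literature.IUT.LogThetaLattice Literature.IUT.LogVolume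
  Literature.IUT.HodgeTheaters
open Literature.NumberTheory.NumberFields Literature.NumberTheory.GaloisRepresentations.Ultrametric

variable {F K Fbar : Type} [Field F] [NumberField F] [Field K] [NumberField K] [Algebra F K] [Field Fbar]
  [Algebra F Fbar] [Algebra K Fbar] {E : WeierstrassCurve F} [E.IsElliptic] {l : ℕ} {Pb : BadPlacePredicates K}
  (D : InitialThetaData F K Fbar E l Pb) {logv : PadicLogs K} (hlog : LogvAnalytic logv)
  (M : Type) [Field M] [NumberField M]
  (archPk : ∀ (j : (thetaIndex (pilotDataOfK D K)).Label) (vQ : (thetaIndex (pilotDataOfK D K)).VQ),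
    Set ((logShellsDH (pilotDataOfK D K) logv).Packet j vQ))
  (archSub : ∀ (j : (thetaIndex (pilotDataOfK D K)).Label) (v : (thetaIndex (pilotDataOfK D K)).V),
    Set ((logShellsDH (pilotDataOfK D K) logv).Packet j ((thetaIndex (pilotDataOfK D K)).over v)))
  (Ψ : ℤ → ∀ v : (thetaIndex (pilotDataOfK D K)).V, v ∈ (thetaIndex (pilotDataOfK D K)).Vbad →
    Set ((logShellsDH (pilotDataOfK D K) logv).StarPacket v))
  (act : ℤ → ∀ v : (thetaIndex (pilotDataOfK D K)).V, v ∈ (thetaIndex (pilotDataOfK D K)).Vbad →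
    (logShellsDH (pilotDataOfK D K) logv).StarPacket v → Module.End ℚ ((logShellsDH (pilotDataOfK D K) logv).StarPacket v))
  (Mmod : ℤ → ∀ j : (thetaIndex (pilotDataOfK D K)).LabelStar, Set ((logShellsDH (pilotDataOfK D K) logv).GlobalPacket j.1))
  (region : ℤ → ∀ j : (thetaIndex (pilotDataOfK D K)).LabelStar, FinDivisor M → ∀ vQ : (thetaIndex (pilotDataOfK D K)).VQ,
    Set ((logShellsDH (pilotDataOfK D K) logv).Packet j.1 vQ))
  (n : ℤ) {HT : Type} {LogLink : HT → HT → Type} {IsFull : ∀ {s t : HT}, LogLink s t → Prop}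
  (lat : LGPGaussianLogThetaLattice LogLink IsFull)
  {Frd : Type} {IsoF : Frd → Frd → Type} {Ob : Frd → Type} {realify : Frd → Frd} {Strip : Type}
  {IsoS : Strip → Strip → Type} {Mv : ∀ v : (thetaIndex (pilotDataOfK D K)).V, v ∈ (thetaIndex (pilotDataOfK D K)).Vbad → Type}
  [∀ v h, Monoid (Mv v h)]
  (sig : GlobalLGPFrobenioidSignature (thetaIndex (pilotDataOfK D K)).lstar (thetaIndex (pilotDataOfK D K)).V
    (· ∈ (thetaIndex (pilotDataOfK D K)).Vbad) Frd IsoF Ob realify Strip IsoS Mv)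
  (split : SplittingMonoids Mv) {ObΔ : Type} {N : ∀ v : (thetaIndex (pilotDataOfK D K)).V, v ∈ (thetaIndex (pilotDataOfK D K)).Vbad → Type}
  [∀ v h, Monoid (N v h)] (qData : QPilotData ObΔ N)
  (tq : ∀ (pp : Nat.Primes) (x : (thetaIndex (pilotDataOfK D K)).Fibre (.inr pp)),
    haveI : Fact (pp : ℕ).Prime := ⟨pp.2⟩; kOf (pilotDataOfK D K) pp.1 x)
  (t : ∀ (pp : Nat.Primes) (_ : Fin (pilotDataOfK D K).lstar) (x : (thetaIndex (pilotDataOfK D K)).Fibre (.inr pp)),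
    haveI : Fact (pp : ℕ).Prime := ⟨pp.2⟩; kOf (pilotDataOfK D K) pp.1 x)
  (htq0 : ∀ pp x, tq pp x ≠ 0)
  (htq1 : ∀ (pp : Nat.Primes) (x : (thetaIndex (pilotDataOfK D K)).Fibre (.inr pp)),
    haveI : Fact (pp : ℕ).Prime := ⟨pp.2⟩; placeOf (pilotDataOfK D K) pp.1 x ∉ (pilotDataOfK D K).S → ‖tq pp x‖ = 1)
  (col : ℤ → Column (logShellsDH (pilotDataOfK D K) logv))
  (ht0 : ∀ pp i x, t pp i x ≠ 0)
  (ht : ∀ (pp : Nat.Primes) (i : Fin (pilotDataOfK D K).lstar) (x : (thetaIndex (pilotDataOfK D K)).Fibre (.inr pp)),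
    haveI : Fact (pp : ℕ).Prime := ⟨pp.2⟩
    Real.log ‖t pp i x‖ = -((pilotDataOfK D K).thetaPilot i (placeOf (pilotDataOfK D K) pp.1 x)) *
      logNorm K (placeOf (pilotDataOfK D K) pp.1 x) / localDegree K (placeOf (pilotDataOfK D K) pp.1 x))
  (htq : ∀ (pp : Nat.Primes) (x : (thetaIndex (pilotDataOfK D K)).Fibre (.inr pp)),
    haveI : Fact (pp : ℕ).Prime := ⟨pp.2⟩
    Real.log ‖tq pp x‖ = -((pilotDataOfK D K).qPilot (placeOf (pilotDataOfK D K) pp.1 x)) *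
      logNorm K (placeOf (pilotDataOfK D K) pp.1 x) / localDegree K (placeOf (pilotDataOfK D K) pp.1 x))

include ht0 ht htq in
/-- **PER DATUM, AT GENUINE `K`-LEVEL DATA WITH TORSION-FREE SUB-WILD BAD FIBRES OF ARBITRARY INDICES THE (xi-f) LICENCE IS DECIDED EXACTLY BY
THE PAIR PREDICATE.** For Θ- and q-ideles REALISING the pilot divisors of `X := pilotDataOfK D K`: if every place `x` of `K` over a prime `p`
below a bad place has `p > 2`, `e(x|p) ≤ p − 1` and no `ζ ≠ 1` with `ζ^p = 1` in `K_x`, then abc-iut-c312-1's `Thm311ToCor312.Licence` holds at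
abc-iut-c312-7's `settingPrVolSharp X …` **iff** for every pair of bad places `w, y | p` and every label `j = i+1 ∈ 𝔽_l^⋇`, for THE natural
numbers `P_w = P_q(w)`, `P_y = P_q(y)` (`2l·P_x = e(x|v)·ord_v(q_v)`): `e_y·(e_w·min(D_{j,w}, D_{j,y}) + 1) ≤ e_y·P_w + j·e_w·(e_y − 1)`,
`D_{j,x} = (j²·P_x − 1) div e(x|p)`. (abc-iut-D1-prv's `licence_settingPrVolSharp_pilotDataOfK_iff_of_boundary` is the one-index sub-case, where
only `y = w` matters; gen 5's `…_iff_of_tame_pairs` the sub-case `e(x|p) ≤ p − 2`.)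
[cite: Mochizuki2012, IUTchI Def. 3.1 (b),(c) pp. 61–62; Ex. 3.2 (iv) p. 71; IUTchIII Step (xi) (xi-f) p. 184, Thm. 3.11 (i) p. 154]
[cite: DupuyHilado2025, §3.3, §3.4, §4.7, §4.9] [claim: Mochizuki2012, status: disputed] -/
theorem licence_settingPrVolSharp_pilotDataOfK_iff_of_boundary_pairs
    (hsub : ∀ (pp : Nat.Primes) (x : (thetaIndex (pilotDataOfK D K)).Fibre (.inr pp)),
      haveI : Fact (pp : ℕ).Prime := ⟨pp.2⟩
      (∃ w : (thetaIndex (pilotDataOfK D K)).Fibre (.inr pp), placeOf (pilotDataOfK D K) pp.1 w ∈ (pilotDataOfK D K).S) →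
        2 < (pp : ℕ) ∧ (placeOf (pilotDataOfK D K) pp.1 x).asIdeal.ramificationIdx ℤ ≤ (pp : ℕ) - 1 ∧
          ∀ ζ : kOf (pilotDataOfK D K) pp.1 x, ζ ^ (pp : ℕ) = 1 → ζ = 1) :
    Thm311ToCor312.Licence
        (settingPrVolSharp (pilotDataOfK D K) hlog M archPk archSub Ψ act Mmod region n lat sig split qData tq t htq0 htq1) ↔
      ∀ (pp : Nat.Primes) (i : Fin (pilotDataOfK D K).lstar) (w y : (thetaIndex (pilotDataOfK D K)).Fibre (.inr pp)),
        haveI : Fact (pp : ℕ).Prime := ⟨pp.2⟩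
        placeOf (pilotDataOfK D K) pp.1 w ∈ (pilotDataOfK D K).S → placeOf (pilotDataOfK D K) pp.1 y ∈ (pilotDataOfK D K).S →
          ∀ Pw Py : ℕ, (pilotDataOfK D K).qPilot (placeOf (pilotDataOfK D K) pp.1 w) = Pw →
            (pilotDataOfK D K).qPilot (placeOf (pilotDataOfK D K) pp.1 y) = Py →
            ((placeOf (pilotDataOfK D K) pp.1 y).asIdeal.ramificationIdx ℤ : ℤ) *
                (((placeOf (pilotDataOfK D K) pp.1 w).asIdeal.ramificationIdx ℤ : ℤ) *
                  min (((((i : ℕ) + 1 : ℕ) : ℤ) ^ 2 * (Pw : ℤ) - 1) / ((placeOf (pilotDataOfK D K) pp.1 w).asIdeal.ramificationIdx ℤ : ℤ))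
                    (((((i : ℕ) + 1 : ℕ) : ℤ) ^ 2 * (Py : ℤ) - 1) / ((placeOf (pilotDataOfK D K) pp.1 y).asIdeal.ramificationIdx ℤ : ℤ)) +
                  1) ≤
              ((placeOf (pilotDataOfK D K) pp.1 y).asIdeal.ramificationIdx ℤ : ℤ) * (Pw : ℤ) +
                ((i : ℕ) + 1 : ℕ) * ((placeOf (pilotDataOfK D K) pp.1 w).asIdeal.ramificationIdx ℤ : ℤ) *
                  (((placeOf (pilotDataOfK D K) pp.1 y).asIdeal.ramificationIdx ℤ : ℤ) - 1) := by
  classical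
  -- THE integer q-degree at the bad places (and a dummy `0` elsewhere)
  let P : ∀ pp : Nat.Primes, (thetaIndex (pilotDataOfK D K)).Fibre (.inr pp) → ℕ := fun pp w =>
    haveI : Fact (pp : ℕ).Prime := ⟨pp.2⟩
    if h : placeOf (pilotDataOfK D K) pp.1 w ∈ (pilotDataOfK D K).S then (exists_nat_qPilot_pilotDataOfK D h).choose else 0
  have hP : ∀ (pp : Nat.Primes) (w : (thetaIndex (pilotDataOfK D K)).Fibre (.inr pp)),
      haveI : Fact (pp : ℕ).Prime := ⟨pp.2⟩
      placeOf (pilotDataOfK D K) pp.1 w ∈ (pilotDataOfK D K).S →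
        (pilotDataOfK D K).qPilot (placeOf (pilotDataOfK D K) pp.1 w) = P pp w := by
    intro pp w hw
    haveI : Fact (pp : ℕ).Prime := ⟨pp.2⟩
    simp only [P, dif_pos hw]
    exact (exists_nat_qPilot_pilotDataOfK D hw).choose_spec.1
  rw [licence_settingPrVolSharp_iff_of_realises_boundary_pairs (pilotDataOfK D K) hlog M archPk archSub Ψ act Mmod region n lat sig split
    qData tq t htq0 htq1 ht0 ht htq hsub P hP]
  refine forall₄_congr fun pp i w y => forall_congr' fun hw => forall_congr' fun hy => ?_
  haveI : Fact (pp : ℕ).Prime := ⟨pp.2⟩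
  constructor
  · intro h Pw Py hPw hPy
    have hw' : P pp w = Pw := by have := (hP pp w hw).symm.trans hPw; exact_mod_cast this
    have hy' : P pp y = Py := by have := (hP pp y hy).symm.trans hPy; exact_mod_cast this
    rw [← hw', ← hy']
    exact h
  · intro h
    exact h (P pp w) (P pp y) (hP pp w hw) (hP pp y hy)

include ht0 ht htq in
/-- **PER DATUM, BRANCH C's ANTECEDENT «∃ ρ qK, QPinned ∧ PilotKummerCompatHull» AT GENUINE `K`-LEVEL DATA WITH TORSION-FREE SUB-WILD BAD
FIBRES OF ARBITRARY INDICES IS THE SAME PAIR PREDICATE** (any columns `col`). [cite: Mochizuki2012, IUTchI Def. 3.1 (b),(c) pp. 61–62; Ex. 3.2 (iv) p. 71; IUTchIII Step (xi) (xi-f) p. 184]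
[cite: DupuyHilado2025, §3.3, §3.4, §4.9] [claim: Mochizuki2012, status: disputed] -/
theorem exists_qPinned_and_hull_settingPrVolSharp_pilotDataOfK_iff_of_boundary_pairs
    (hsub : ∀ (pp : Nat.Primes) (x : (thetaIndex (pilotDataOfK D K)).Fibre (.inr pp)),
      haveI : Fact (pp : ℕ).Prime := ⟨pp.2⟩
      (∃ w : (thetaIndex (pilotDataOfK D K)).Fibre (.inr pp), placeOf (pilotDataOfK D K) pp.1 w ∈ (pilotDataOfK D K).S) →
        2 < (pp : ℕ) ∧ (placeOf (pilotDataOfK D K) pp.1 x).asIdeal.ramificationIdx ℤ ≤ (pp : ℕ) - 1 ∧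
          ∀ ζ : kOf (pilotDataOfK D K) pp.1 x, ζ ^ (pp : ℕ) = 1 → ζ = 1) :
    (∃ (ρ' : (∀ v : (thetaIndex (pilotDataOfK D K)).V, v ∈ (thetaIndex (pilotDataOfK D K)).Vbad →
            Set ((logShellsDH (pilotDataOfK D K) logv).StarPacket v)) →
          ∀ (j : (thetaIndex (pilotDataOfK D K)).Label) (vQ : (thetaIndex (pilotDataOfK D K)).VQ),
            Set ((logShellsDH (pilotDataOfK D K) logv).Packet j vQ))
        (qK : ∀ v : (thetaIndex (pilotDataOfK D K)).V, v ∈ (thetaIndex (pilotDataOfK D K)).Vbad →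
          Set ((logShellsDH (pilotDataOfK D K) logv).StarPacket v)),
        QPinned ({ toSituation := situationPrVol (pilotDataOfK D K) hlog M archPk archSub Ψ act Mmod region, col := col } :
            LatticeSituation (thetaIndex (pilotDataOfK D K)))
          (settingPrVolSharp (pilotDataOfK D K) hlog M archPk archSub Ψ act Mmod region n lat sig split qData tq t htq0 htq1) ρ' qK ∧
        PilotKummerCompatHull ({ toSituation := situationPrVol (pilotDataOfK D K) hlog M archPk archSub Ψ act Mmod region, col := col } :
            LatticeSituation (thetaIndex (pilotDataOfK D K)))
          (settingPrVolSharp (pilotDataOfK D K) hlog M archPk archSub Ψ act Mmod region n lat sig split qData tq t htq0 htq1) ρ' qK) ↔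
      ∀ (pp : Nat.Primes) (i : Fin (pilotDataOfK D K).lstar) (w y : (thetaIndex (pilotDataOfK D K)).Fibre (.inr pp)),
        haveI : Fact (pp : ℕ).Prime := ⟨pp.2⟩
        placeOf (pilotDataOfK D K) pp.1 w ∈ (pilotDataOfK D K).S → placeOf (pilotDataOfK D K) pp.1 y ∈ (pilotDataOfK D K).S →
          ∀ Pw Py : ℕ, (pilotDataOfK D K).qPilot (placeOf (pilotDataOfK D K) pp.1 w) = Pw →
            (pilotDataOfK D K).qPilot (placeOf (pilotDataOfK D K) pp.1 y) = Py →
            ((placeOf (pilotDataOfK D K) pp.1 y).asIdeal.ramificationIdx ℤ : ℤ) *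
                (((placeOf (pilotDataOfK D K) pp.1 w).asIdeal.ramificationIdx ℤ : ℤ) *
                  min (((((i : ℕ) + 1 : ℕ) : ℤ) ^ 2 * (Pw : ℤ) - 1) / ((placeOf (pilotDataOfK D K) pp.1 w).asIdeal.ramificationIdx ℤ : ℤ))
                    (((((i : ℕ) + 1 : ℕ) : ℤ) ^ 2 * (Py : ℤ) - 1) / ((placeOf (pilotDataOfK D K) pp.1 y).asIdeal.ramificationIdx ℤ : ℤ)) +
                  1) ≤
              ((placeOf (pilotDataOfK D K) pp.1 y).asIdeal.ramificationIdx ℤ : ℤ) * (Pw : ℤ) +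
                ((i : ℕ) + 1 : ℕ) * ((placeOf (pilotDataOfK D K) pp.1 w).asIdeal.ramificationIdx ℤ : ℤ) *
                  (((placeOf (pilotDataOfK D K) pp.1 y).asIdeal.ramificationIdx ℤ : ℤ) - 1) := by
  rw [exists_qPinned_and_hull_settingPrVolSharp_iff_licence (pilotDataOfK D K) hlog M archPk archSub Ψ act Mmod region n lat sig split
    qData tq t htq0 htq1 col (fun pp x => norm_qIdele_le_one_of_realises (pilotDataOfK D K) tq htq0 htq pp x)]
  exact licence_settingPrVolSharp_pilotDataOfK_iff_of_boundary_pairs D hlog M archPk archSub Ψ act Mmod region n lat sig split qData tq t htq0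
    htq1 ht0 ht htq hsub

end Summit.ABC.IUTFork.Cor312Prov

end
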